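import Mathlib
import HarnessLib

/-!
# Stub `stub_kellerAlgebra` of the line `birth` — crux `NeutralTaylorWaves.NonresonantSelection`
# (stmt-AnomalousDissipation-16294)

The real-arithmetic half of Keller's bordering lemma of the skeleton
`Cruxes/NonresonantSelection/Lines/birth.lean`.
Letters: `V = ‖v‖₂`, `U = ‖u‖₂` (`u` is `v` minus its component along `φ = ∂₃w`),
`Φ = ‖φ‖₂ > 0`, `Fn = ‖F‖₂` the bordered residual, `b` the drift unknown, `Bd = ⟨v, φ⟩` the
border term, `Pr = |⟨ψ, φ⟩|` the pairing, `Λ ≥ 1` the single largeness parameter and `ρ, ρ'`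
the smallness of the approximate kernel / cokernel.

Proof. Put `t := |Bd / Φ²| = |Bd| / Φ²`, so `t Φ² = |Bd|`.
1. `1 ≤ ΛΦ` gives `tΦ ≤ Λ|Bd|` and `t ≤ Λ²|Bd|`, hence `Λ t ρ ≤ ρΛ³ |Bd| ≤ |Bd|`.
2. `1 ≤ Λ Pr` and `|b| Pr ≤ Fn + ρ'V` give `|b| ≤ Λ (Fn + ρ'V)`.
3. `U ≤ ΛFn + ΛΦ|b| + Λtρ ≤ ΛFn + Λ³(Fn + ρ'V) + |Bd| ≤ ΛFn + Λ³Fn + V/2 + |Bd|`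
   (`Φ ≤ Λ`, `2ρ'Λ³ ≤ 1`).
4. `V ≤ U + tΦ` then gives `V ≤ 2(Λ + Λ³)Fn + 2(1 + Λ)|Bd| ≤ 4Λ³(Fn + |Bd|)`.
5. `|b| ≤ ΛFn + Λρ'V ≤ ΛFn + V/2 ≤ 3Λ³Fn + 2Λ³|Bd|` (`Λρ' ≤ ρ'Λ³ ≤ 1/2`).
6. `V + |b| ≤ 7Λ³(Fn + |Bd|)`, so
   `V² + b² ≤ (V + |b|)² ≤ 49Λ⁶ · 2(Fn² + Bd²) ≤ (10Λ³)² (Fn² + Bd²)`.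
-/

-- `Summit.<Summit>.<Problem>` is the tree's mandated summit-side namespace; for this single-conjunct
-- summit the two segments coincide, so the duplicate is deliberate.
set_option linter.dupNamespace false

noncomputable section

namespace Summit.AnomalousDissipation.AnomalousDissipation.Theorems

/-- The squaring endgame in `ℝ²`: if `0 ≤ V`, `0 ≤ c` and `V + c ≤ 7L(F + B)`, then
`V² + c² ≤ (V + c)² ≤ 49L² · 2(F² + B²) ≤ 100L²(F² + B²)`. -/
theorem nonresonantSelection_kalg_sq_add_sq_le (V c F B L : ℝ) (hV : 0 ≤ V) (hc : 0 ≤ c)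
    (h : V + c ≤ 7 * L * (F + B)) : V ^ 2 + c ^ 2 ≤ 100 * L ^ 2 * (F ^ 2 + B ^ 2) := by
  have hsq : (V + c) ^ 2 ≤ (7 * L * (F + B)) ^ 2 := pow_le_pow_left₀ (add_nonneg hV hc) h 2
  nlinarith [hsq, mul_nonneg hV hc, mul_nonneg (sq_nonneg L) (sq_nonneg (F - B)),
    mul_nonneg (sq_nonneg L) (sq_nonneg F), mul_nonneg (sq_nonneg L) (sq_nonneg B)]

/-- **Stub `stub_kellerAlgebra`** (line `birth` of crux `NeutralTaylorWaves.NonresonantSelection`,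
stmt-AnomalousDissipation-16294) — the real-arithmetic half of KELLER'S BORDERING LEMMA. With
`t = |Bd / Φ²|`: the splitting `V ≤ U + tΦ`, the approximate-kernel bound
`U ≤ Λ(Fn + |b|Φ + tρ)` and the approximate-cokernel bound `|b| Pr ≤ Fn + ρ'V`, under the
largeness / smallness `1 ≤ Λ`, `ρΛ³ ≤ 1`, `2ρ'Λ³ ≤ 1`, `Φ ≤ Λ`, `1 ≤ ΛΦ`, `1 ≤ Λ Pr`, give
`V ≤ 4Λ³(Fn + |Bd|)` and `|b| ≤ 3Λ³Fn + 2Λ³|Bd|`, whence `V² + b² ≤ (10Λ³)² (Fn² + Bd²)`. -/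
theorem stub_kellerAlgebra :
    ∀ (Λ ρ ρ' V U Φ Fn b Bd Pr : ℝ),
      1 ≤ Λ → 0 ≤ ρ → 0 ≤ ρ' → ρ * Λ ^ 3 ≤ 1 → 2 * ρ' * Λ ^ 3 ≤ 1 →
      0 ≤ V → 0 ≤ U → 0 ≤ Fn → 0 < Φ → Φ ≤ Λ → 1 ≤ Λ * Φ → 1 ≤ Λ * Pr →
      V ≤ U + |Bd / Φ ^ 2| * Φ →
      U ≤ Λ * (Fn + |b| * Φ + |Bd / Φ ^ 2| * ρ) →
      |b| * Pr ≤ Fn + ρ' * V →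
      V ^ 2 + b ^ 2 ≤ (10 * Λ ^ 3) ^ 2 * (Fn ^ 2 + Bd ^ 2) := by
  intro Λ ρ ρ' V U Φ Fn b Bd Pr hΛ hρ hρ' hρΛ hρ'Λ hV _hU hFn hΦ hΦΛ hΛΦ hΛPr hVU hUle hbPr
  -- the border quotient `t = |Bd / Φ²|`, with `t Φ² = |Bd|`
  obtain ⟨t, ht⟩ : ∃ t, t = |Bd / Φ ^ 2| := ⟨_, rfl⟩
  rw [← ht] at hVU hUle
  have hΛ0 : 0 ≤ Λ := zero_le_one.trans hΛ
  have hB0 : 0 ≤ |Bd| := abs_nonneg Bd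
  have hb0 : 0 ≤ |b| := abs_nonneg b
  have ht0 : 0 ≤ t := by rw [ht]; exact abs_nonneg _
  have htΦ : t * Φ ^ 2 = |Bd| := by
    rw [ht, abs_div, abs_of_pos (pow_pos hΦ 2)]
    exact div_mul_cancel₀ _ (pow_pos hΦ 2).ne'
  have hΛ2 : 1 ≤ Λ ^ 2 := one_le_pow₀ hΛ
  have hL3 : 1 ≤ Λ ^ 3 := one_le_pow₀ hΛ
  have hLle : Λ ≤ Λ ^ 3 :=
    calc Λ = Λ * 1 := (mul_one Λ).symm
      _ ≤ Λ * Λ ^ 2 := mul_le_mul_of_nonneg_left hΛ2 hΛ0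
      _ = Λ ^ 3 := by ring
  -- Step 1: the border quotient against `1 ≤ ΛΦ` and `ρΛ³ ≤ 1`
  have hsΦ : t * Φ ≤ Λ * |Bd| :=
    calc t * Φ = t * Φ * 1 := (mul_one _).symm
      _ ≤ t * Φ * (Λ * Φ) := mul_le_mul_of_nonneg_left hΛΦ (mul_nonneg ht0 hΦ.le)
      _ = Λ * (t * Φ ^ 2) := by ring
      _ = Λ * |Bd| := by rw [htΦ]
  have htB : t ≤ Λ ^ 2 * |Bd| :=
    calc t = t * 1 := (mul_one _).symm
      _ ≤ t * (Λ * Φ) ^ 2 := mul_le_mul_of_nonneg_left (one_le_pow₀ hΛΦ) ht0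
      _ = Λ ^ 2 * (t * Φ ^ 2) := by ring
      _ = Λ ^ 2 * |Bd| := by rw [htΦ]
  have hsρ : Λ * (t * ρ) ≤ |Bd| :=
    calc Λ * (t * ρ) = Λ * ρ * t := by ring
      _ ≤ Λ * ρ * (Λ ^ 2 * |Bd|) := mul_le_mul_of_nonneg_left htB (mul_nonneg hΛ0 hρ)
      _ = ρ * Λ ^ 3 * |Bd| := by ring
      _ ≤ 1 * |Bd| := mul_le_mul_of_nonneg_right hρΛ hB0
      _ = |Bd| := one_mul _
  -- Step 2: the drift against the pairing `1 ≤ Λ Pr`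
  have hK0 : 0 ≤ Fn + ρ' * V := add_nonneg hFn (mul_nonneg hρ' hV)
  have hb1 : |b| ≤ Λ * (Fn + ρ' * V) :=
    calc |b| = |b| * 1 := (mul_one _).symm
      _ ≤ |b| * (Λ * Pr) := mul_le_mul_of_nonneg_left hΛPr hb0
      _ = Λ * (|b| * Pr) := by ring
      _ ≤ Λ * (Fn + ρ' * V) := mul_le_mul_of_nonneg_left hbPr hΛ0
  -- Step 3: the bound on `U`
  have hc1 : Λ * Φ * |b| ≤ Λ * Φ * (Λ * (Fn + ρ' * V)) :=
    mul_le_mul_of_nonneg_left hb1 (mul_nonneg hΛ0 hΦ.le)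
  have hc2 : Φ * (Λ ^ 2 * (Fn + ρ' * V)) ≤ Λ * (Λ ^ 2 * (Fn + ρ' * V)) :=
    mul_le_mul_of_nonneg_right hΦΛ (mul_nonneg (pow_nonneg hΛ0 2) hK0)
  have hc3 : ρ' * Λ ^ 3 * V ≤ 1 / 2 * V := mul_le_mul_of_nonneg_right (by linarith) hV
  have hU2 : U ≤ Λ * Fn + Λ ^ 3 * Fn + V / 2 + |Bd| := by
    linarith [hUle, hsρ, hc1, hc2, hc3]
  -- Step 4: the bound on `V`
  have hFn1 : Λ * Fn ≤ Λ ^ 3 * Fn := mul_le_mul_of_nonneg_right hLle hFn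
  have hBd1 : |Bd| ≤ Λ ^ 3 * |Bd| := le_mul_of_one_le_left hB0 hL3
  have hBd2 : Λ * |Bd| ≤ Λ ^ 3 * |Bd| := mul_le_mul_of_nonneg_right hLle hB0
  have hV2 : V ≤ 4 * Λ ^ 3 * Fn + 4 * Λ ^ 3 * |Bd| := by
    linarith [hVU, hsΦ, hU2, hFn1, hBd1, hBd2]
  -- Step 5: the bound on `|b|`
  have he1 : Λ * ρ' ≤ 1 / 2 := by
    have h := mul_le_mul_of_nonneg_left hΛ2 (mul_nonneg hΛ0 hρ')
    linarith [h, hρ'Λ]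
  have he2 : Λ * ρ' * V ≤ 1 / 2 * V := mul_le_mul_of_nonneg_right he1 hV
  have hb2 : |b| ≤ 3 * Λ ^ 3 * Fn + 2 * Λ ^ 3 * |Bd| := by
    linarith [hb1, he2, hV2, hFn1]
  -- Step 6: add and square
  have hsum : V + |b| ≤ 7 * Λ ^ 3 * (Fn + |Bd|) := by
    linarith [hV2, hb2, mul_nonneg (zero_le_one.trans hL3) hB0]
  have key := nonresonantSelection_kalg_sq_add_sq_le V |b| Fn |Bd| (Λ ^ 3) hV hb0 hsum
  rw [sq_abs, sq_abs] at key
  calc V ^ 2 + b ^ 2 ≤ 100 * (Λ ^ 3) ^ 2 * (Fn ^ 2 + Bd ^ 2) := key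
    _ = (10 * Λ ^ 3) ^ 2 * (Fn ^ 2 + Bd ^ 2) := by ring

end Summit.AnomalousDissipation.AnomalousDissipation.Theorems
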